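import Summits.KontsevichZagierPeriods.KontsevichZagierPeriods.Theorems.LiouvilleUnfoldingAyoubPiLocalKernelNilCut
import Summits.KontsevichZagierPeriods.KontsevichZagierPeriods.Theorems.ReducedPeriodRing.Negative.Certificates
import Literature.AlgebraicGeometry.HodgeTheory.ComplexPointsLifting
import Literature.NumberTheory.Transcendental.KZLogCalculusProofs

/-!
# Crux stmt-KontsevichZagierPeriods-0541 (`AyoubPiLocalKernel`): the formal period ring is countable,
# and the transcendence stub (N) of line `nilradical-cut` in COMPLEX-POINTS form

Support file (`--supports` stmt-KontsevichZagierPeriods-0541, line `SketchIdeator2` = card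
`nilradical-cut`, lead cycle 4).  Write `P := KZ.FormalPeriodRing = FormalRep ⧸ relations` for the
formal period ring of the four-move calculus (`KZRulesAssociator.lean`), `evalP : P →+* ℝ` for the
evaluation and `ϖ := KZ.toFormalPeriod (KZ.of KZ.piRep)` for the class of the disc `[π]`.  The lead's
registered stub of the line is the transcendence half

  `(N)  ∀ x : P, evalP x = 0 → ∃ N k, ϖ ^ N * x ^ (k + 1) = 0`

(every class of value `0` is `ϖ`-locally nilpotent), known in prime form
(`nilLocalKernel_iff_primes`, p138233): every prime `q ∌ ϖ` of `P` contains `ker evalP`.  The idea card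
(`Cruxes/AyoubPiLocalKernel/Ideas/nilradical-cut.md`, "Why it bites" (3)) reads this as a statement about
"field-valued multiplicative integration theories, WLOG with values in `ℂ` since `P` is countable".
This file kernel-checks that reading:

* `countable_formalPeriodRing` — **`P` is countable**: a representation is determined modulo
  relations by the pair (domain, graph of the integrand over the domain) of `ℚ`-semialgebraic sets
  (`KZ.of_sub_of_mem_relations_of_eqOn`), there are countably many such sets
  (`countable_setOf_isSemialgebraic`), and `P` is generated as a group by the classes of
  representations;
* `charZero_quotient_formalPeriodRing`, `exists_ringHom_complex_ker_eq` — every prime quotient of `P`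
  has characteristic `0` (positive integers are units of `P`, `isUnit_natCast_formalPeriodRing`), so
  by Steinitz (`nonempty_ringHom_complex_of_countable`) **every prime ideal of `P` is the kernel of a
  ring homomorphism `P →+* ℂ`** — a "complex-valued multiplicative integration theory" of the
  four-move calculus;
* `isNilpotent_iff_forall_ringHom_complex` — in such a ring an element is nilpotent iff it is killed
  by every ring homomorphism to `ℂ`;
* `locallyNil_iff_isNilpotent_mul` — `x` is `ϖ`-locally nilpotent iff `ϖ * x` is nilpotent, hence
  (`locallyNil_iff_forall_ringHom_complex`) iff `θ x = 0` for every `θ : P →+* ℂ` with `θ ϖ ≠ 0`;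
* `nilLocalKernel_iff_complexPoints` — **(N) ↔ every ring homomorphism `θ : P →+* ℂ` with
  `θ ϖ ≠ 0` kills `ker evalP`** (every complex integration theory in which the disc is non-zero
  satisfies every identity of Lebesgue's); `ayoubPiLocalKernel_iff_complexPoints_and_locallyReduced` —
  the crux is that statement together with the transcendence-free stub (R);
* `not_nilLocalKernel_iff_exists_complexPoint` — what a refutation of (N) is: one `θ : P →+* ℂ` with
  `θ ϖ ≠ 0` and one class `x` of value `0` with `θ x ≠ 0`;
* `summit_iff_sq_and_complexPoints` — for comparison, the summit itself is "squares of value zero are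
  relations" (crux stmt-3929 `ReducedPeriodRing`) together with "EVERY `θ : P →+* ℂ` kills `ker evalP`".

No definition is introduced; nothing conjecture-grade is asserted (all statements are unconditional
structure theorems or equivalences).  References: J. Ayoub, *Periods and the conjectures of Grothendieck
and Kontsevich–Zagier*, EMS Newsl. 91 (2014), Conj. 7; A. Huber, S. Müller-Stach, *Periods and Nori
Motives* (2017), Conj. 13.2.5; M. Kontsevich, D. Zagier, *Periods* (2001), §1.1 ("`P` is obviously
countable" — here for the FORMAL ring).  Mathlib: `FreeAbelianGroup` of a countable type is countable,
`nilpotent_iff_mem_prime`, `IsFractionRing.div_surjective`, `charZero_of_injective_algebraMap`.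
-/

noncomputable section

open Set
open Literature.NumberTheory.Transcendental
open Literature.ModelTheory.ExponentialFields (IsSemialgebraic)

namespace Summit.KontsevichZagierPeriods.LiouvilleUnfolding.NilradicalCut

open Summit.KontsevichZagierPeriods.LiouvilleUnfolding.PiLocalKernelPosition
open Summit.KontsevichZagierPeriods.KontsevichZagierPeriods.Theses.LiouvilleUnfolding (AyoubPiLocalKernel)
open Summit.KontsevichZagierPeriods.KontsevichZagierPeriods.ReducedPeriodRingNegative
  (isUnit_natCast_formalPeriodRing)
open Literature.AlgebraicGeometry.HodgeTheory (nonempty_ringHom_complex_of_countable)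

/-! ## 1. The formal period ring is countable -/

/-- Two functions with the same graph over `σ` (graphs realised with `Fin.snoc`, as in
`IsSemialgebraicFunOn`) agree on `σ`. [folklore] -/
theorem eqOn_of_graph_eq {n : ℕ} {σ : Set (Fin n → ℝ)} {f g : (Fin n → ℝ) → ℝ}
    (h : {z : Fin (n + 1) → ℝ | ∃ x ∈ σ, z = Fin.snoc x (f x)} =
      {z : Fin (n + 1) → ℝ | ∃ x ∈ σ, z = Fin.snoc x (g x)}) :
    EqOn f g σ := by
  intro x hx
  have hz : (Fin.snoc x (f x) : Fin (n + 1) → ℝ) ∈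
      {z : Fin (n + 1) → ℝ | ∃ x ∈ σ, z = Fin.snoc x (g x)} := by
    rw [← h]
    exact ⟨x, hx, rfl⟩
  obtain ⟨x', -, hxx'⟩ := hz
  have h1 : x = x' := by simpa only [Fin.init_snoc] using congrArg Fin.init hxx'
  have h2 : f x = g x' := by simpa only [Fin.snoc_last] using congrFun hxx' (Fin.last n)
  rw [h2, h1]

/-- A representation is determined MODULO RELATIONS by its domain and the graph of its integrand over
the domain (integrand additivity with a zero representation, `KZ.of_sub_of_mem_relations_of_eqOn`).
[Kontsevich–Zagier 2001, §1.2 rule (1)] [folklore] -/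
theorem toFormalPeriod_of_eq_of_graph_eq {n : ℕ} {r r' : KZ.IntegralRep n}
    (hd : r.domain = r'.domain)
    (hg : {z : Fin (n + 1) → ℝ | ∃ x ∈ r.domain, z = Fin.snoc x (r.integrand x)} =
      {z : Fin (n + 1) → ℝ | ∃ x ∈ r'.domain, z = Fin.snoc x (r'.integrand x)}) :
    KZ.toFormalPeriod (KZ.of r) = KZ.toFormalPeriod (KZ.of r') := by
  rw [← hd] at hg
  exact KZ.toFormalPeriod_eq_iff.mpr
    (KZ.of_sub_of_mem_relations_of_eqOn hd.symm (eqOn_of_graph_eq hg))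

/-- In each dimension the classes of representations form a countable subset of `P`: the class of `r`
only depends on the pair (domain, graph of the integrand over the domain), a pair of `ℚ`-semialgebraic
sets, of which there are countably many (`countable_setOf_isSemialgebraic`). [folklore] -/
theorem countable_range_toFormalPeriod_of (n : ℕ) :
    (range fun r : KZ.IntegralRep n => KZ.toFormalPeriod (KZ.of r)).Countable := by
  -- the countable set of keys and the key of a representation
  set K : Set (Set (Fin n → ℝ) × Set (Fin (n + 1) → ℝ)) :=
    {σ : Set (Fin n → ℝ) | IsSemialgebraic ℚ σ} ×ˢ {G : Set (Fin (n + 1) → ℝ) | IsSemialgebraic ℚ G}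
    with hKdef
  have hK : K.Countable :=
    (countable_setOf_isSemialgebraic ℚ (Fin n)).prod (countable_setOf_isSemialgebraic ℚ (Fin (n + 1)))
  let key : KZ.IntegralRep n → Set (Fin n → ℝ) × Set (Fin (n + 1) → ℝ) := fun r =>
    (r.domain, {z : Fin (n + 1) → ℝ | ∃ x ∈ r.domain, z = Fin.snoc x (r.integrand x)})
  have hkey : ∀ r : KZ.IntegralRep n, key r ∈ K := fun r =>
    mk_mem_prod r.isSemialgebraic_domain r.isSemialgebraicFunOn_integrand
  -- the fibre of the class map over a key is a subsingleton
  let S : Set (Fin n → ℝ) × Set (Fin (n + 1) → ℝ) → Set KZ.FormalPeriodRing := fun k =>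
    {y | ∃ r : KZ.IntegralRep n, key r = k ∧ y = KZ.toFormalPeriod (KZ.of r)}
  have hS : ∀ k, (S k).Subsingleton := by
    rintro k _ ⟨r, hr, rfl⟩ _ ⟨r', hr', rfl⟩
    have hkk : key r = key r' := hr.trans hr'.symm
    exact toFormalPeriod_of_eq_of_graph_eq (congrArg Prod.fst hkk) (congrArg Prod.snd hkk)
  have hU : (⋃ k ∈ K, S k).Countable := hK.biUnion fun k _ => (hS k).finite.countable
  refine hU.mono ?_
  rintro _ ⟨r, rfl⟩
  exact mem_biUnion (hkey r) ⟨r, rfl, rfl⟩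

/-- **The formal period ring of the four-move calculus is countable.**  `P` is generated as an additive
group by the classes of representations (`KZ.FormalPeriodRing.induction_on`), a countable set
(`countable_range_toFormalPeriod_of`), so it is the image of the free abelian group on a countable type.
[Kontsevich–Zagier 2001, §1.1] [folklore] -/
theorem countable_formalPeriodRing : Countable KZ.FormalPeriodRing := by
  have hG : (⋃ n : ℕ, range fun r : KZ.IntegralRep n => KZ.toFormalPeriod (KZ.of r)).Countable :=
    countable_iUnion fun n => countable_range_toFormalPeriod_of n
  set G : Set KZ.FormalPeriodRing :=
    ⋃ n : ℕ, range fun r : KZ.IntegralRep n => KZ.toFormalPeriod (KZ.of r) with hGdef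
  haveI : Countable G := hG.to_subtype
  let L : FreeAbelianGroup G →+ KZ.FormalPeriodRing :=
    FreeAbelianGroup.lift fun g => (g : KZ.FormalPeriodRing)
  have hL : Function.Surjective L := by
    intro x
    induction x using KZ.FormalPeriodRing.induction_on with
    | zero => exact ⟨0, map_zero L⟩
    | hof n r =>
      exact ⟨FreeAbelianGroup.of ⟨KZ.toFormalPeriod (KZ.of r), mem_iUnion.mpr ⟨n, r, rfl⟩⟩,
        FreeAbelianGroup.lift_apply_of _ _⟩
    | neg x hx =>
      obtain ⟨a, rfl⟩ := hx
      exact ⟨-a, map_neg L a⟩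
    | add x y hx hy =>
      obtain ⟨a, rfl⟩ := hx
      obtain ⟨b, rfl⟩ := hy
      exact ⟨a + b, map_add L a b⟩
  exact hL.countable

/-! ## 2. Residue fields of `P` embed in `ℂ`; nilpotents are detected by complex points -/

/-- Every proper quotient of the formal period ring has characteristic zero: every positive integer is
a unit of `P` (`isUnit_natCast_formalPeriodRing`), hence a unit — in particular non-zero — in the
quotient. [folklore] -/
theorem charZero_quotient_formalPeriodRing (q : Ideal KZ.FormalPeriodRing) (hq : q.IsPrime) :
    CharZero (KZ.FormalPeriodRing ⧸ q) := by
  haveI : Nontrivial (KZ.FormalPeriodRing ⧸ q) := Ideal.Quotient.nontrivial_iff.mpr hq.ne_top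
  refine charZero_of_inj_zero fun N hN => ?_
  by_contra hN0
  have hu : IsUnit ((N : ℕ) : KZ.FormalPeriodRing ⧸ q) := by
    have h := (isUnit_natCast_formalPeriodRing (Nat.pos_of_ne_zero hN0)).map (Ideal.Quotient.mk q)
    rwa [map_natCast] at h
  exact hu.ne_zero hN

/-- In a countable commutative ring all of whose prime quotients have characteristic zero, **every
prime ideal is the kernel of a ring homomorphism to `ℂ`**: the fraction field of the quotient is a
countable field of characteristic zero, which embeds in `ℂ` (Steinitz,
`nonempty_ringHom_complex_of_countable`). [folklore] -/
theorem exists_ringHom_complex_ker_eq {A : Type} [CommRing A] [Countable A]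
    (hA : ∀ q : Ideal A, q.IsPrime → CharZero (A ⧸ q)) (q : Ideal A) (hq : q.IsPrime) :
    ∃ θ : A →+* ℂ, RingHom.ker θ = q := by
  haveI := hq
  haveI : CharZero (A ⧸ q) := hA q hq
  let k := FractionRing (A ⧸ q)
  haveI : CharZero k := charZero_of_injective_algebraMap (IsFractionRing.injective (A ⧸ q) k)
  haveI : Countable (A ⧸ q) := Ideal.Quotient.mk_surjective.countable
  haveI : Countable k := by
    refine Function.Surjective.countable
      (f := fun p : (A ⧸ q) × (A ⧸ q) => algebraMap (A ⧸ q) k p.1 / algebraMap (A ⧸ q) k p.2)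
      fun z => ?_
    obtain ⟨a, b, -, h⟩ := IsFractionRing.div_surjective (A := A ⧸ q) z
    exact ⟨(a, b), h⟩
  obtain ⟨σ⟩ := nonempty_ringHom_complex_of_countable k
  refine ⟨(σ.comp (algebraMap (A ⧸ q) k)).comp (Ideal.Quotient.mk q), ?_⟩
  ext a
  rw [RingHom.mem_ker, RingHom.comp_apply, RingHom.comp_apply, map_eq_zero_iff σ σ.injective,
    map_eq_zero_iff _ (IsFractionRing.injective (A ⧸ q) k), Ideal.Quotient.eq_zero_iff_mem]

/-- In such a ring an element is **nilpotent iff it is killed by every ring homomorphism to `ℂ`**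
(`nilpotent_iff_mem_prime` + `exists_ringHom_complex_ker_eq`). [folklore] -/
theorem isNilpotent_iff_forall_ringHom_complex {A : Type} [CommRing A] [Countable A]
    (hA : ∀ q : Ideal A, q.IsPrime → CharZero (A ⧸ q)) (a : A) :
    IsNilpotent a ↔ ∀ θ : A →+* ℂ, θ a = 0 := by
  constructor
  · intro ha θ
    exact (ha.map θ).eq_zero
  · intro h
    rw [nilpotent_iff_mem_prime]
    intro q hq
    obtain ⟨θ, hθ⟩ := exists_ringHom_complex_ker_eq hA q hq
    rw [← hθ, RingHom.mem_ker]
    exact h θ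

/-- **Every prime ideal of the formal period ring is the kernel of a complex-valued multiplicative
integration theory `θ : P →+* ℂ`.** [folklore] -/
theorem exists_ringHom_complex_ker_eq_formalPeriodRing (q : Ideal KZ.FormalPeriodRing)
    (hq : q.IsPrime) : ∃ θ : KZ.FormalPeriodRing →+* ℂ, RingHom.ker θ = q :=
  haveI := countable_formalPeriodRing
  exists_ringHom_complex_ker_eq charZero_quotient_formalPeriodRing q hq

/-- A formal period is nilpotent iff every `θ : P →+* ℂ` kills it. [folklore] -/
theorem isNilpotent_iff_forall_ringHom_complex_formalPeriodRing (x : KZ.FormalPeriodRing) :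
    IsNilpotent x ↔ ∀ θ : KZ.FormalPeriodRing →+* ℂ, θ x = 0 :=
  haveI := countable_formalPeriodRing
  isNilpotent_iff_forall_ringHom_complex charZero_quotient_formalPeriodRing x

/-! ## 3. `ϖ`-local nilpotency and the stub (N) on complex points -/

/-- `x` is `ϖ`-locally nilpotent (`ϖ ^ N * x ^ (k + 1) = 0` for some `N k`) iff `ϖ * x` is nilpotent
(`P` is non-trivial, so the exponent `0` does not occur). [folklore] -/
theorem locallyNil_iff_isNilpotent_mul (x : KZ.FormalPeriodRing) :
    (∃ N k : ℕ, KZ.toFormalPeriod (KZ.of KZ.piRep) ^ N * x ^ (k + 1) = 0) ↔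
      IsNilpotent (KZ.toFormalPeriod (KZ.of KZ.piRep) * x) := by
  set p := KZ.toFormalPeriod (KZ.of KZ.piRep) with hp
  constructor
  · rintro ⟨N, k, h⟩
    refine ⟨N + (k + 1), ?_⟩
    have heq : (p * x) ^ (N + (k + 1)) = p ^ (k + 1) * x ^ N * (p ^ N * x ^ (k + 1)) := by ring
    rw [heq, h, mul_zero]
  · rintro ⟨m, hm⟩
    cases m with
    | zero => simp at hm
    | succ k => exact ⟨k + 1, k, by rw [← mul_pow]; exact hm⟩

/-- **Pointwise complex form**: `x` is `ϖ`-locally nilpotent iff `θ x = 0` for every ring homomorphism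
`θ : P →+* ℂ` with `θ ϖ ≠ 0` — i.e. iff `x` vanishes at every complex point of `Spec P[ϖ⁻¹]`.
[cite: HuberMullerStachPeriods2017, Conj. 13.2.5] -/
theorem locallyNil_iff_forall_ringHom_complex (x : KZ.FormalPeriodRing) :
    (∃ N k : ℕ, KZ.toFormalPeriod (KZ.of KZ.piRep) ^ N * x ^ (k + 1) = 0) ↔
      ∀ θ : KZ.FormalPeriodRing →+* ℂ, θ (KZ.toFormalPeriod (KZ.of KZ.piRep)) ≠ 0 → θ x = 0 := by
  rw [locallyNil_iff_isNilpotent_mul, isNilpotent_iff_forall_ringHom_complex_formalPeriodRing]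
  simp only [map_mul, mul_eq_zero]
  constructor
  · intro h θ hθ
    exact (h θ).resolve_left hθ
  · intro h θ
    by_cases hθ : θ (KZ.toFormalPeriod (KZ.of KZ.piRep)) = 0
    · exact Or.inl hθ
    · exact Or.inr (h θ hθ)

/-- **The transcendence stub (N) in complex-points form.**  (N) holds iff every ring homomorphism
`θ : P →+* ℂ` with `θ ϖ ≠ 0` — every complex-valued, multiplicative, four-move-invariant integration
theory of `ℚ`-semialgebraic data in which the disc does not vanish — kills every class of value `0`,
i.e. satisfies every identity that Lebesgue integration satisfies.  (`→` needs no countability; `←`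
realises every prime `q ∌ ϖ` as such a kernel.) [cite: Ayoub2014, Conj. 7]
[cite: HuberMullerStachPeriods2017, Conj. 13.2.5] -/
theorem nilLocalKernel_iff_complexPoints :
    (∀ x : KZ.FormalPeriodRing, KZ.evalP x = 0 →
        ∃ N k : ℕ, KZ.toFormalPeriod (KZ.of KZ.piRep) ^ N * x ^ (k + 1) = 0) ↔
      ∀ θ : KZ.FormalPeriodRing →+* ℂ, θ (KZ.toFormalPeriod (KZ.of KZ.piRep)) ≠ 0 →
        RingHom.ker KZ.evalP ≤ RingHom.ker θ := by
  constructor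
  · intro h θ hθ x hx
    rw [RingHom.mem_ker] at hx ⊢
    exact (locallyNil_iff_forall_ringHom_complex x).mp (h x hx) θ hθ
  · intro h x hx
    exact (locallyNil_iff_forall_ringHom_complex x).mpr fun θ hθ =>
      RingHom.mem_ker.mp (h θ hθ (RingHom.mem_ker.mpr hx))

/-- **What a refutation of (N) is**: a ring homomorphism `θ : P →+* ℂ` with `θ ϖ ≠ 0` and a class `x`
of value `0` with `θ x ≠ 0` — an exotic complex integration theory violating a true identity among real
periods while keeping the disc non-zero. [folklore] -/
theorem not_nilLocalKernel_iff_exists_complexPoint :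
    (¬ ∀ x : KZ.FormalPeriodRing, KZ.evalP x = 0 →
        ∃ N k : ℕ, KZ.toFormalPeriod (KZ.of KZ.piRep) ^ N * x ^ (k + 1) = 0) ↔
      ∃ θ : KZ.FormalPeriodRing →+* ℂ, θ (KZ.toFormalPeriod (KZ.of KZ.piRep)) ≠ 0 ∧
        ∃ x : KZ.FormalPeriodRing, KZ.evalP x = 0 ∧ θ x ≠ 0 := by
  rw [nilLocalKernel_iff_complexPoints]
  constructor
  · intro h
    by_contra hne
    apply h
    intro θ hθ x hx
    by_contra hx'
    exact hne ⟨θ, hθ, x, RingHom.mem_ker.mp hx, fun h0 => hx' (RingHom.mem_ker.mpr h0)⟩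
  · rintro ⟨θ, hθ, x, hx, hθx⟩ h
    exact hθx (RingHom.mem_ker.mp (h θ hθ (RingHom.mem_ker.mpr hx)))

/-- **The crux in complex-points form**: item stmt-0541 holds iff (every `θ : P →+* ℂ` with `θ ϖ ≠ 0`
kills `ker evalP`) and (R) (`ϖ`-locally nilpotent classes are `ϖ`-power torsion).
[cite: Ayoub2014, Conj. 7] -/
theorem ayoubPiLocalKernel_iff_complexPoints_and_locallyReduced :
    AyoubPiLocalKernel ↔
      (∀ θ : KZ.FormalPeriodRing →+* ℂ, θ (KZ.toFormalPeriod (KZ.of KZ.piRep)) ≠ 0 →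
          RingHom.ker KZ.evalP ≤ RingHom.ker θ) ∧
        (∀ x : KZ.FormalPeriodRing,
          (∃ N k : ℕ, KZ.toFormalPeriod (KZ.of KZ.piRep) ^ N * x ^ (k + 1) = 0) →
            ∃ N : ℕ, KZ.toFormalPeriod (KZ.of KZ.piRep) ^ N * x = 0) := by
  rw [ayoubPiLocalKernel_iff_nil_and_locallyReduced, nilLocalKernel_iff_complexPoints]

/-- (R) in the same vocabulary: every class killed by all complex points of `Spec P[ϖ⁻¹]` is `ϖ`-power
torsion (i.e. vanishes in `P[ϖ⁻¹]`): `Spec P[ϖ⁻¹]` has no embedded nilpotent structure invisible to its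
complex points. [folklore] -/
theorem locallyReducedOnTorsion_iff_complexPoints :
    (∀ x : KZ.FormalPeriodRing,
        (∃ N k : ℕ, KZ.toFormalPeriod (KZ.of KZ.piRep) ^ N * x ^ (k + 1) = 0) →
          ∃ N : ℕ, KZ.toFormalPeriod (KZ.of KZ.piRep) ^ N * x = 0) ↔
      ∀ x : KZ.FormalPeriodRing,
        (∀ θ : KZ.FormalPeriodRing →+* ℂ, θ (KZ.toFormalPeriod (KZ.of KZ.piRep)) ≠ 0 → θ x = 0) →
          ∃ N : ℕ, KZ.toFormalPeriod (KZ.of KZ.piRep) ^ N * x = 0 := by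
  refine forall_congr' fun x => ?_
  rw [locallyNil_iff_forall_ringHom_complex]

/-! ## 4. For comparison: the summit on complex points -/

/-- **The summit in the same form.**  The Kontsevich–Zagier period conjecture for this calculus holds
iff (i) formal combinations whose square is a relation are relations (the statement of crux stmt-3929
`ReducedPeriodRing`: `P` is reduced) and (ii) EVERY ring homomorphism `θ : P →+* ℂ` kills `ker evalP`
(the value-kernel lies in every prime, i.e. in the nilradical).  Compare item 0541 =
(ii restricted to `θ ϖ ≠ 0`) ∧ (R). [cite: KontsevichZagier2001, §1.2 Conjecture 1] -/
theorem summit_iff_sq_and_complexPoints :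
    KontsevichZagierPeriods ↔
      (∀ c : KZ.FormalRep, c * c ∈ KZ.relations → c ∈ KZ.relations) ∧
        ∀ θ : KZ.FormalPeriodRing →+* ℂ, RingHom.ker KZ.evalP ≤ RingHom.ker θ := by
  have e : KZKernelConjecture ↔ KontsevichZagierPeriods := kzKernelConjecture_iff_isRational
  rw [← e]
  constructor
  · intro hK
    have hinj : ∀ x : KZ.FormalPeriodRing, KZ.evalP x = 0 → x = 0 := by
      intro x hx
      obtain ⟨c, rfl⟩ := KZ.toFormalPeriod_surjective x
      exact KZ.toFormalPeriod_eq_zero_iff.mpr (hK c hx)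
    refine ⟨fun c hc => ?_, fun θ x hx => ?_⟩
    · apply hK c
      have h0 : KZ.evalP (KZ.toFormalPeriod (c * c)) = 0 := by
        rw [KZ.toFormalPeriod_eq_zero_of_mem hc, map_zero]
      rw [map_mul, map_mul, KZ.evalP_toFormalPeriod] at h0
      exact mul_self_eq_zero.mp h0
    · rw [RingHom.mem_ker] at hx ⊢
      rw [hinj x hx, map_zero]
  · rintro ⟨hsq, hθ⟩ c hc
    have hc' : KZ.toFormalPeriod c ∈ RingHom.ker KZ.evalP := by
      rw [RingHom.mem_ker, KZ.evalP_toFormalPeriod]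
      exact hc
    have hnil : IsNilpotent (KZ.toFormalPeriod c) :=
      (isNilpotent_iff_forall_ringHom_complex_formalPeriodRing _).mpr fun θ =>
        RingHom.mem_ker.mp (hθ θ hc')
    haveI : IsReduced KZ.FormalPeriodRing := by
      refine (isReduced_iff_pow_one_lt 2 one_lt_two).mpr fun y hy => ?_
      obtain ⟨d, rfl⟩ := KZ.toFormalPeriod_surjective y
      rw [sq, ← map_mul, KZ.toFormalPeriod_eq_zero_iff] at hy
      exact KZ.toFormalPeriod_eq_zero_iff.mpr (hsq d hy)
    exact KZ.toFormalPeriod_eq_zero_iff.mp hnil.eq_zero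

end Summit.KontsevichZagierPeriods.LiouvilleUnfolding.NilradicalCut

end
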